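import Literature.MathematicalPhysics.QuantumManyBody.YukawaShortCutoff
import HarnessLib

/-!
# The Fourier transform of the Yukawa potential

Topic `Literature/MathematicalPhysics/QuantumManyBody` (electrostatics groundwork for the charged
Bose gas, `JelliumBoseGas.foldyLaw`). The sliding method of [ConlonLiebYau1988, Lemma 2.1;
LiebSolovej2001, Lemma 3.1] and the cutoff estimates of [LiebSolovej2001, §4] rest on the Fourier
transform of the Yukawa potential `Y_ν(x) = e^{-ν|x|}/|x|` on `ℝ³`: `Ŷ_ν(p) = 4π/(|p|² + ν²)`
(physicists' convention), i.e. with Mathlib's `𝓕 f(p) = ∫ e^{-2πi⟨x,p⟩} f(x) dx`,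

**`𝓕(e^{-√μ|·|}/(4π|·|))(p) = 1/(4π²|p|² + μ)`** (`μ > 0`), equivalently
`𝓕(e^{-√μ|·|}/|·|)(p) = 4π/(4π²|p|² + μ)` [LiebLoss2001, Thm. 6.23 (Yukawa potential)].

Proof by subordination: `e^{-√μ|x|}/(4π|x|) = ∫₀^∞ e^{-μs} G_s(x) ds`
(`Coulomb.integral_Ioi_exp_neg_mul_heatKernel`), `𝓕G_s(p) = e^{-4π²s|p|²}`
(`fourierIntegral_heatKernel_holds`), Fubini (the integrand has absolute integral `1/μ`,
`Coulomb.lintegral_space_lintegral_exp_neg_mul_heatKernel`), and `∫₀^∞ e^{-(μ + 4π²|p|²)s} ds =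
1/(μ + 4π²|p|²)`.

* `Coulomb.fourierIntegral_subordinatedYukawa` — for the subordinated kernel `∫₀^∞ e^{-μs}G_s ds`.
* `Coulomb.fourierIntegral_yukawa` — **`𝓕(e^{-√μ|·|}/(4π|·|))(p) = 1/(4π²|p|² + μ)`**.
* `Coulomb.fourierIntegral_yukawa'` — `𝓕(e^{-√μ|·|}/|·|)(p) = 4π/(4π²|p|² + μ)`.

## References

* [LiebLoss2001] E. H. Lieb, M. Loss, *Analysis*, 2nd ed., AMS GSM 14 (2001), Thm. 6.23.
* [ConlonLiebYau1988] J. G. Conlon, E. H. Lieb, H.-T. Yau, Commun. Math. Phys. 116 (1988) 417–448,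
  Lemma 2.1 (proof).
* [LiebSolovej2001] E. H. Lieb, J. P. Solovej, Commun. Math. Phys. 217 (2001) 127–163, §§3–4.
-/

noncomputable section

open MeasureTheory Set Filter Real
open scoped ENNReal NNReal Topology FourierTransform RealInnerProductSpace
open Literature.Analysis.UnboundedOperators

namespace Literature.MathematicalPhysics.QuantumManyBody.Coulomb

open BoseGas

/-- The subordination integrand `(y, s) ↦ e^{-μs} G_s(y)` is integrable on `ℝ³ × (0, ∞)`
(absolute integral `1/μ`). [folklore] -/
theorem integrable_exp_neg_mul_heatKernel_prod {μ : ℝ} (hμ : 0 < μ) :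
    Integrable (fun q : Space × ℝ => Real.exp (-(μ * q.2)) * heatKernel q.2 q.1)
      ((volume : Measure Space).prod (volume.restrict (Ioi (0 : ℝ)))) := by
  have hm : Measurable fun q : Space × ℝ => Real.exp (-(μ * q.2)) * heatKernel q.2 q.1 :=
    (Real.measurable_exp.comp (measurable_const.mul measurable_snd).neg).mul
      (measurable_heatKernel_uncurry.comp (measurable_snd.prodMk measurable_fst))
  have hlin : ∫⁻ q, ‖Real.exp (-(μ * q.2)) * heatKernel q.2 q.1‖ₑ
      ∂((volume : Measure Space).prod (volume.restrict (Ioi (0 : ℝ)))) = ENNReal.ofReal (1 / μ) := by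
    rw [lintegral_prod (fun q : Space × ℝ => ‖Real.exp (-(μ * q.2)) * heatKernel q.2 q.1‖ₑ)
      hm.enorm.aemeasurable, ← lintegral_space_lintegral_exp_neg_mul_heatKernel hμ]
    refine lintegral_congr fun y => setLIntegral_congr_fun measurableSet_Ioi fun s hs => ?_
    rw [Real.enorm_eq_ofReal (mul_nonneg (Real.exp_pos _).le
      (heatKernel_pos (show (0:ℝ) < s from hs) y).le)]
  refine ⟨hm.aestronglyMeasurable, ?_⟩
  show ∫⁻ q, ‖Real.exp (-(μ * q.2)) * heatKernel q.2 q.1‖ₑ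
      ∂((volume : Measure Space).prod (volume.restrict (Ioi (0 : ℝ)))) < ⊤
  rw [hlin]
  exact ENNReal.ofReal_lt_top

/-- `∫₀^∞ e^{-μs} e^{-4π²s|p|²} ds = 1/(4π²|p|² + μ)`. [folklore] -/
theorem integral_Ioi_exp_neg_mul_heatSymbol {μ : ℝ} (hμ : 0 < μ) (p : Space) :
    ∫ s in Ioi (0 : ℝ), Real.exp (-(μ * s)) * heatSymbol s p = 1 / (4 * π ^ 2 * ‖p‖ ^ 2 + μ) := by
  have hμ' : 0 < μ + (2 * π) ^ 2 * ‖p‖ ^ 2 := by positivity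
  have e : ∀ s : ℝ, Real.exp (-(μ * s)) * heatSymbol s p =
      Real.exp (-((μ + (2 * π) ^ 2 * ‖p‖ ^ 2) * s)) := by
    intro s
    rw [heatSymbol, ← Real.exp_add]
    congr 1
    ring
  simp_rw [e]
  rw [(integral_Ioi_exp_neg_mul hμ').2]
  congr 1
  ring

/-- **Fourier transform of the subordinated Yukawa kernel**: for `μ > 0`,
`𝓕(y ↦ ∫₀^∞ e^{-μs}G_s(y) ds)(p) = 1/(4π²|p|² + μ)` (Fubini and `𝓕G_s = e^{-4π²s|p|²}`).
[cite: LiebLoss2001, Thm. 6.23] -/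
theorem fourierIntegral_subordinatedYukawa {μ : ℝ} (hμ : 0 < μ) (p : Space) :
    𝓕 (fun y : Space => ((∫ s in Ioi (0 : ℝ), Real.exp (-(μ * s)) * heatKernel s y : ℝ) : ℂ)) p =
      ((1 / (4 * π ^ 2 * ‖p‖ ^ 2 + μ) : ℝ) : ℂ) := by
  have hF := integrable_exp_neg_mul_heatKernel_prod hμ
  -- the integrand `(y, s) ↦ 𝐞(-⟪y,p⟫) e^{-μs} G_s(y)` on `ℝ³ × (0, ∞)`
  have hsw : Integrable (fun q : Space × ℝ => ((Real.fourierChar (-⟪q.1, p⟫) : ℂ)) *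
      ((Real.exp (-(μ * q.2)) * heatKernel q.2 q.1 : ℝ) : ℂ))
      ((volume : Measure Space).prod (volume.restrict (Ioi (0 : ℝ)))) := by
    have h1 : Integrable (fun q : Space × ℝ => ((Real.exp (-(μ * q.2)) * heatKernel q.2 q.1 : ℝ) : ℂ))
        ((volume : Measure Space).prod (volume.restrict (Ioi (0 : ℝ)))) := hF.ofReal
    refine h1.norm.mono' ?_ (Eventually.of_forall fun q => ?_)
    · have hc : Continuous fun q : Space × ℝ => -⟪q.1, p⟫ := (continuous_fst.inner continuous_const).neg
      exact (continuous_subtype_val.comp (Real.continuous_fourierChar.comp hc)).aestronglyMeasurable.mul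
        h1.aestronglyMeasurable
    · rw [norm_mul, Circle.norm_coe, one_mul]
  simp only [Real.fourier_eq, Circle.smul_def, smul_eq_mul]
  calc ∫ y : Space, ((Real.fourierChar (-⟪y, p⟫) : ℂ)) *
        ((∫ s in Ioi (0 : ℝ), Real.exp (-(μ * s)) * heatKernel s y : ℝ) : ℂ)
      = ∫ y : Space, ∫ s in Ioi (0 : ℝ), ((Real.fourierChar (-⟪y, p⟫) : ℂ)) *
          ((Real.exp (-(μ * s)) * heatKernel s y : ℝ) : ℂ) := by
        refine integral_congr_ae (Eventually.of_forall fun y => ?_)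
        dsimp only
        rw [← integral_complex_ofReal, ← integral_const_mul]
    _ = ∫ s in Ioi (0 : ℝ), ∫ y : Space, ((Real.fourierChar (-⟪y, p⟫) : ℂ)) *
          ((Real.exp (-(μ * s)) * heatKernel s y : ℝ) : ℂ) := integral_integral_swap hsw
    _ = ∫ s in Ioi (0 : ℝ), ((Real.exp (-(μ * s)) * heatSymbol s p : ℝ) : ℂ) := by
        refine setIntegral_congr_fun measurableSet_Ioi fun s hs => ?_
        have hs0 : (0 : ℝ) < s := hs
        have hK := fourierIntegral_heatKernel_holds (E := Space) hs0 p
        simp only [Real.fourier_eq, Circle.smul_def, smul_eq_mul] at hK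
        have e : ∀ y : Space, ((Real.fourierChar (-⟪y, p⟫) : ℂ)) *
            ((Real.exp (-(μ * s)) * heatKernel s y : ℝ) : ℂ) =
            (Real.exp (-(μ * s)) : ℂ) * (((Real.fourierChar (-⟪y, p⟫) : ℂ)) * (heatKernel s y : ℂ)) := by
          intro y
          push_cast
          ring
        simp_rw [e]
        rw [integral_const_mul, hK]
        push_cast
        ring
    _ = ((∫ s in Ioi (0 : ℝ), Real.exp (-(μ * s)) * heatSymbol s p : ℝ) : ℂ) := integral_complex_ofReal
    _ = ((1 / (4 * π ^ 2 * ‖p‖ ^ 2 + μ) : ℝ) : ℂ) := by rw [integral_Ioi_exp_neg_mul_heatSymbol hμ p]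

/-- **Fourier transform of the Yukawa potential** [LiebLoss2001, Thm. 6.23]: for `μ > 0`,
`𝓕(e^{-√μ|·|}/(4π|·|))(p) = 1/(4π²|p|² + μ)` on `ℝ³` (Mathlib's convention
`𝓕 f(p) = ∫ e^{-2πi⟨x,p⟩} f(x) dx`; the value of the function at `x = 0` is immaterial).
[cite: LiebLoss2001, Thm. 6.23] -/
theorem fourierIntegral_yukawa {μ : ℝ} (hμ : 0 < μ) (p : Space) :
    𝓕 (fun y : Space => ((Real.exp (-(Real.sqrt μ * ‖y‖)) / (4 * π * ‖y‖) : ℝ) : ℂ)) p =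
      ((1 / (4 * π ^ 2 * ‖p‖ ^ 2 + μ) : ℝ) : ℂ) := by
  rw [← fourierIntegral_subordinatedYukawa hμ p]
  simp only [Real.fourier_eq, Circle.smul_def, smul_eq_mul]
  have hae : ∀ᵐ y : Space ∂volume, y ≠ 0 := by
    have : (volume : Measure Space) {y | ¬y ≠ 0} = 0 := by
      simp only [ne_eq, not_not, setOf_eq_eq_singleton, measure_singleton]
    exact ae_iff.2 this
  refine integral_congr_ae ?_
  filter_upwards [hae] with y hy
  rw [(integral_Ioi_exp_neg_mul_heatKernel hy hμ).2]

/-- **Fourier transform of the Yukawa potential**, classical normalization: for `μ > 0`,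
`𝓕(e^{-√μ|·|}/|·|)(p) = 4π/(4π²|p|² + μ)` on `ℝ³`. [cite: LiebLoss2001, Thm. 6.23] -/
theorem fourierIntegral_yukawa' {μ : ℝ} (hμ : 0 < μ) (p : Space) :
    𝓕 (fun y : Space => ((Real.exp (-(Real.sqrt μ * ‖y‖)) / ‖y‖ : ℝ) : ℂ)) p =
      ((4 * π / (4 * π ^ 2 * ‖p‖ ^ 2 + μ) : ℝ) : ℂ) := by
  have h := fourierIntegral_yukawa hμ p
  simp only [Real.fourier_eq, Circle.smul_def, smul_eq_mul] at h ⊢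
  have e : ∀ y : Space, ((Real.fourierChar (-⟪y, p⟫) : ℂ)) *
      ((Real.exp (-(Real.sqrt μ * ‖y‖)) / ‖y‖ : ℝ) : ℂ) =
      ((4 * π : ℝ) : ℂ) * (((Real.fourierChar (-⟪y, p⟫) : ℂ)) *
        ((Real.exp (-(Real.sqrt μ * ‖y‖)) / (4 * π * ‖y‖) : ℝ) : ℂ)) := by
    intro y
    by_cases hy : y = 0
    · subst hy
      simp
    · have hyn : ‖y‖ ≠ 0 := norm_ne_zero_iff.2 hy
      have hπ : (π : ℝ) ≠ 0 := Real.pi_pos.ne'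
      push_cast
      field_simp
  simp_rw [e]
  rw [integral_const_mul, h]
  push_cast
  have hden : ((4 * π ^ 2 * ‖p‖ ^ 2 + μ : ℝ) : ℂ) ≠ 0 := by
    exact_mod_cast (by positivity : (4 * π ^ 2 * ‖p‖ ^ 2 + μ : ℝ) ≠ 0)
  field_simp

end Literature.MathematicalPhysics.QuantumManyBody.Coulomb
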